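import Literature.NumberTheory.EllipticCurves.ComplexMultiplicationBurungaleFlachDescentProofs
import Literature.NumberTheory.EllipticCurves.ComplexMultiplicationSingularModuli
import Literature.NumberTheory.EllipticCurves.ComplexMultiplicationShaProofs
import Literature.NumberTheory.EllipticCurves.ComplexPeriodProofs
import Literature.NumberTheory.EllipticCurves.LFunctionSmulProofs
import Literature.NumberTheory.EllipticCurves.UniformizationUniqueProofs
import Literature.NumberTheory.QuadraticFields.ClassNumberOne
import Mathlib.Analysis.Calculus.Deriv.Star
import Mathlib.NumberTheory.NumberField.Discriminant.Basic
import HarnessLib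

/-!
# bsd.S28 (Burungale–Flach), level 3 of the decomposition: Corollary 1 over the CM field from
Theorem 1.1, by the printed proof

Third proof file of `Literature.NumberTheory.EllipticCurves.ComplexMultiplication` for
**bsd.S28**; sibling of `ComplexMultiplicationBurungaleFlachDescent.lean`, whose level-2 leaf
`Literature.NumberTheory.EllipticCurves.BurungaleFlach2024_bsd_cmField` is Burungale–Flach, Camb. J. Math. 12 (2024),
**Corollary 1** ("BSD for `E/F`") at `F = K` for the base change `E_K` of a CM curve `E/ℚ`
(CM by `𝓞_K`, `L(E/ℚ,1) ≠ 0`): `E(K)`, `Ш(E/K)` finite and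
`L(E/K,1)/Ω(E) = |Ш(E/K)| / |E(K)|² · ∏_v |Φ_v|`. The paper proves Corollary 1 in three lines
(arXiv p. 3):

> *Proof.* This follows from the identity [Shimura, Thm. 7.42]
> `L(E/F,s) = L(ψ̄,s) · conj L(ψ̄,s) = L(ψ̄,s) L(ψ,s)`, the fact that `N_{K/ℚ}(|A|_K) = |A|`
> for any finite `𝓞_K`-module `A`, and (periodnorm) [`Ω(E)·ℤ = N_{K/ℚ}𝔞 = ΩΩ̄·𝔞(Ω)𝔞(Ω)bar`].

from **Theorem 1.1**: for `E/F` with CM by `𝓞_K`, `F(E_tors)/K` abelian and `L(ψ̄,1) ≠ 0`,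
the `𝓞_K`-modules `E(F)`, `Ш(E/F)` are finite, `L(ψ̄,1)/Ω ∈ K^×`, and
`(L(ψ̄,1)/Ω) = |Ш(E/F)|_K / |E(F)| · ∏_v |Φ_v|_K · 𝔞(Ω)` in the group of fractional `𝓞_K`-ideals
(here `⊗_v H_1(E(F_v),ℤ) = 𝔞 · det_{𝓞_K} Hom_{𝓞_F}(H⁰(ℰ,Ω_{ℰ/𝓞_F}),𝓞_F)` under the period
isomorphism, `𝔞 = Ω·𝔞(Ω)`, `|A|_K` the order ideal), together with **Remark 1**: *"not only the
ideal `|E(F)|` but also the ideal `|Ш(E/F)|_K` is generated by a rational integer [Gross,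
Prop. 3.7]. The ideals `|Φ_v|_K` are equal to either `(1)`, `(2)` or `𝔭` with `𝔭² = (2)` or
`𝔭² = (3)` [Gross, Prop. 4.5]."*

This file performs exactly this step, sorry-free, for the curves of the level-2 leaf. At `F = K`
(one complex place, `h_K = 1`, p. 4) and on a globally minimal model `W'` of `E_K` (so that
`ω = dx/(2y + a₁x + a₃)` is a Néron differential, `H⁰(ℰ,Ω) = 𝓞_K ω`, `I_ω = 1`, Remark 2) the
invertible `𝓞_K`-module `𝔞 ⊂ K_ℝ ≅ ℂ` *is* the period lattice `Λ_ω` of `W'` along an embedding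
`σ : K → ℂ` (evaluate the period isomorphism at `ω`), and since `h_K = 1` one may take
`𝔞(Ω) = (1)`, i.e. `Ω` an `𝓞_K`-generator of `Λ_ω`: `Λ_ω = Ω · 𝓞_K`, `𝓞_K = ℤ[(d_K + √d_K)/2] ⊂ ℂ`
(the tree's `cmRing`, the normalisation `IsCMPeriod` of `ComplexMultiplicationCoatesWiles.lean`).
Theorem 1.1 is vendored in this setting as the named fact

* `BurungaleFlach2024_main_cmField` — **Theorem 1.1 with Remark 1 at `F = K`**, for `E_K`,
  `E/ℚ` with `j(E) ∈ maximalCMJInvariants` and `L(E/ℚ,1) ≠ 0` (which satisfy its hypotheses,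
  p. 4), transcribed without Grössencharacters and without `𝓞_K`-module structures exactly as
  the tree's other CM facts are (`Deuring_LFunction_baseChange_cmField`,
  `Rubin1987_sha_torsionBy_eq_bot_cofinite`, `CoatesWiles1977_L_one_div_period_mem_prime`):
  `L(ψ̄,1) = L(E/ℚ,1)` (Deuring, Silverman *AT* II.10.5(b): `L(E/ℚ,s) = L(s,ψ_{E_K/K})`, whose
  coefficients are integers so `L(s,ψ̄) = L(s,ψ)`), and the ideal identity in the equivalent
  squared form `(L(ψ̄,1)/Ω)² (|E(K)|)² = (|Ш(E/K)|) (∏_v c_v)`, i.e.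
  `z² |E(K)|² = u · |Ш(E/K)| · ∏_v c_v` for `z = L(ψ̄,1)/Ω ∈ K` and a unit `u ∈ 𝓞_K^×` — by
  Remark 1 and `N_{K/ℚ}(|A|_K) = |A|` one has `|Ш|_K² = (n)² = (|Ш|)` and `|Φ_v|_K² = (c_v)`
  (`(1)² = (1)`, `(2)² = (4)`, `𝔭² = (2)`, `𝔭² = (3)` with `c_v = |Φ_v| = N|Φ_v|_K = 1, 4, 2, 3`),
  so squaring the printed identity gives this form, and conversely it recovers the printed one
  by unique factorisation of ideals; nothing is lost and nothing is added;

and Corollary 1 is **derived** from it and three facts already in the tree: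

* `exists_isCMPeriod_of_j_mem_maximalCMJInvariants` (`ComplexMultiplicationCoatesWiles.lean`;
  Coates–Wiles 1977 §1, "`L = Ω𝓞`"; reduced in `ComplexMultiplicationSingularModuli.lean` to
  the table of singular moduli, two rows proved): the period lattice of `E/ℚ` is `Ω · 𝓞_K` —
  the existence of the `𝓞_K`-generator `Ω` (Burungale–Flach p. 3: "`H_1(E(F_v),ℤ)` is an
  invertible `𝓞_K`-module", with `h_K = 1`);
* `Deuring_LFunction_baseChange_cmField` (`L(E_K/K,s) = L(E/ℚ,s)²`, the Grössencharacter-free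
  form of Shimura 7.42 / Deuring for these curves) and `hasEntireLFunction_rat` (modularity,
  for the continuation to `s = 1`);

everything else being **proved** here:

* `WeierstrassCurve.conj_entireLFunction` : `conj L(E,s) = L(E,s̄)` (integer coefficients and
  uniqueness of the continuation), so `L(E/ℚ,1) ∈ ℝ` and `L(E_K/K,1) = |L(ψ̄,1)|²` — the first
  line of the printed proof;
* `norm_embedding_unit_eq_one` : `|σ(u)| = 1` for `u ∈ 𝓞_K^×`, `K` imaginary quadratic, whence
  `N_{K/ℚ}` of the ideal identity: `|σ z|² |E(K)|² = |Ш| ∏ c_v` — the second line;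
* `bsdPeriod_eq_norm_sq_of_coe_lattice_eq` : **(periodnorm) at `F = K`**:
  `Ω(E_K) = bsdPeriod W' = 2 covol(Ω𝓞_K)/√|d_K| = |Ω|²`, from `covol(ℤ[ω_d]) = √|d|/2`
  (`covolume_cmPeriodPair`, an explicit `2 × 2` determinant), `covol(cΛ) = |c|² covol(Λ)` and
  `d_K = d` for the nine fields (`Literature.NumberTheory.EllipticCurves.Quadratic.discr_eq_of_sq_eq_intCast`: `disc(1, φ) = r² d_K`
  for `φ = (1+√d)/2` resp. `√d/2`, and `|d_K| > 2`) — the third line;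
* `BurungaleFlach2024_bsd_cmField_of_main` : the assembly, i.e. **Corollary 1 at `F = K` from
  Theorem 1.1** (`L(E_K,1)/Ω(E_K) = L(E/ℚ,1)²/|Ω|² = |σz|² = |Ш|∏c_v/|E(K)|²`), and
  `bsdTriple_of_j_mem_maximalCMJInvariants_of_L_one_ne_zero_of_main` : bsd.S28 from Theorem 1.1
  and the standard facts of levels 1–3.

After this file bsd.S28 rests, sorry-free, on Theorem 1.1 of Burungale–Flach over `K` (the
Iwasawa-theoretic heart: the two-variable main conjecture of Johnson-Leung–Kings, Kato's explicit
reciprocity law and the equivariant Tamagawa number formalism, §§2–3 of the paper), the CM period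
lattice (singular moduli), Deuring's theorem, modularity, and the descent inputs of
`ComplexMultiplicationBurungaleFlachDescentProofs.lean`. The next level (Theorem 1.1 itself)
needs Iwasawa modules over `ℤ_p⟦Gal(K(E_{p^∞})/K)⟧`, elliptic units and `p`-adic Hodge theory,
none of which is in the tree or in Mathlib.

## Design and faithfulness notes

* `BurungaleFlach2024_main_cmField` quantifies over the embedding `σ : K →+* ℂ`, a period pair
  `L` of `W'.map σ` (`g₂(L) = c₄/12`, `g₃(L) = c₆/216`, the convention of `ComplexPeriod.lean`)
  and an `𝓞_K`-generator `Ω` of its lattice (`L.lattice = Ω · cmRing d_K`); Theorem 1.1 is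
  intrinsic (everything lives in `K_ℝ`), so it holds for either identification `K_ℝ ≅ ℂ`, and
  for these curves `L(σ ∘ ψ̄, 1) = L(E/ℚ,1)` for both. The membership `L(ψ̄,1)/Ω ∈ K^×` is
  `∃ z : K, σ z · Ω = L(E/ℚ,1)` (`z ≠ 0` being automatic from `L(E/ℚ,1) ≠ 0`).
* `|E(F)|` in Theorem 1.1 is the integer `#E(F)` (as a principal ideal), `|Φ_v| = c_v`
  (Lemma "localvolume" and Cor. 5: `Φ_v = E(F_v)/E(F_v)⁰`), `∏_v c_v = tamagawaProduct`,
  `|Ш(E/K)| = shaOrder`, as in the level-2 dictionary.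
* Vacuity: as for the level-2 facts (`27a1`, `32a2`, `49a1`, …); `Ω` exists by
  `exists_isCMPeriod_of_j_mem_maximalCMJInvariants` (proved outright for `j = 0, 1728`).

## References

* A. Burungale, M. Flach, *The conjecture of Birch and Swinnerton-Dyer for certain elliptic curves
  with complex multiplication*, Camb. J. Math. 12 (2024) (arXiv:2206.09874): §1, the period
  isomorphism and `𝔞 = Ω𝔞(Ω)` (p. 3), Thm. 1.1, Remark 1, eq. (periodnorm), Cor. 1 and its proof
  (p. 3), the first two sentences of p. 4, Remark 2. [BurungaleFlach2024]
* B. H. Gross, *On the conjecture of Birch and Swinnerton-Dyer for elliptic curves with complex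
  multiplication*, in: Number theory related to Fermat's last theorem, Progr. Math. 26 (1982),
  Prop. 3.7 and Prop. 4.5 — cited through Remark 1 of [BurungaleFlach2024].
* J. H. Silverman, *Advanced Topics in the Arithmetic of Elliptic Curves*, GTM 151 (1994), II §1
  (pp. 102–104: `E_Λ ∈ ELL(R_K)`, `Λ = c·𝔞`, Prop. 1.2), Thm. II.10.5 (Deuring), App. A §3.
  [SilvermanATAEC1994]
* J. Coates, A. Wiles, *On the conjecture of Birch and Swinnerton-Dyer*, Invent. Math. 39 (1977),
  §1 p. 225 (`L = Ω𝓞`). [CoatesWiles1977]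
* D. A. Marcus, *Number Fields*, Ch. 2, Thm. 1 and Exercise 27 (discriminants of quadratic
  fields). [folklore]
-/

noncomputable section

open scoped Classical ComplexConjugate

open Complex MeasureTheory NumberField

/-! ### `L(E, s̄) = conj L(E, s)`: the central value is real -/

namespace WeierstrassCurve

variable {K₀ : Type*} [Field K₀] [NumberField K₀] (W : WeierstrassCurve K₀)

/-- An `L`-series with integer coefficients commutes with complex conjugation:
`conj (∑ aₙ n^{-s}) = ∑ aₙ n^{-s̄}`. [folklore] -/
theorem conj_LSeries_intCast (a : ℕ → ℤ) (s : ℂ) :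
    conj (LSeries (fun n => (a n : ℂ)) s) = LSeries (fun n => (a n : ℂ)) (conj s) := by
  simp only [LSeries]
  rw [conj_tsum]
  refine tsum_congr fun n => ?_
  rcases Nat.eq_zero_or_pos n with rfl | hn
  · simp [LSeries.term]
  · rw [LSeries.term_of_ne_zero hn.ne', LSeries.term_of_ne_zero hn.ne', map_div₀, map_intCast]
    congr 1
    have harg : ((n : ℂ)).arg ≠ Real.pi := by
      rw [Complex.natCast_arg]; exact Real.pi_pos.ne
    have h := Complex.conj_cpow (n : ℂ) (conj s) harg
    rw [Complex.conj_conj, map_natCast] at h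
    exact h.symm

/-- **`conj L(E, s) = L(E, s̄)` for the entire `L`-function** of a Weierstrass curve over a
number field admitting an entire continuation. The Dirichlet coefficients of `L(E,s)` are
integers, so the identity holds on the half-plane of absolute convergence `Re s > 3/2`; the
function `s ↦ conj L(E, s̄)` is again an entire continuation of the `L`-series, hence equals
`W.entireLFunction` by uniqueness of the continuation (`subsingleton_entireContinuations`, the
identity theorem). Lapid–Rallis (2003), Introduction ("`L(s,π)` is real for `s ∈ ℝ`");
cf. the named fact `leadingLCoeff_im_eq_zero` of `BSDInvariants.lean`. [folklore] -/
theorem conj_entireLFunction (h : W.HasEntireLFunction) (s : ℂ) :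
    conj (W.entireLFunction s) = W.entireLFunction (conj s) := by
  set g : ℂ → ℂ := fun s => conj (W.entireLFunction (conj s)) with hg
  have hgmem : g ∈ W.entireContinuations := by
    refine ⟨?_, ?_⟩
    · intro z
      have hd : DifferentiableAt ℂ W.entireLFunction (conj z) :=
        (W.differentiable_entireLFunction h) _
      have h2 := hd.conj_conj
      rw [Complex.conj_conj] at h2
      exact h2
    · intro z hz
      have hz' : (3 / 2 : ℝ) < (conj z).re := by rwa [conj_re]
      show conj (W.entireLFunction (conj z)) = W.LSeries z
      rw [W.entireLFunction_eq_LSeries h hz', WeierstrassCurve.LSeries, WeierstrassCurve.LSeries]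
      have := conj_LSeries_intCast (fun n => W.LFunction n) (conj z)
      rw [Complex.conj_conj] at this
      exact this
  have heq : g = W.entireLFunction :=
    W.subsingleton_entireContinuations hgmem (W.entireLFunction_mem h)
  have := congrFun heq (conj s)
  simp only [hg, Complex.conj_conj] at this
  exact this

/-- In particular `L(E, x)` is real for real `x`: `conj L(E,x) = L(E,x)` (e.g. `L(E,1) ∈ ℝ`).
[folklore] -/
theorem conj_entireLFunction_ofReal (h : W.HasEntireLFunction) (x : ℝ) :
    conj (W.entireLFunction x) = W.entireLFunction x := by
  rw [W.conj_entireLFunction h, conj_ofReal]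

/-- `Im L(E, x) = 0` for real `x`. [folklore] -/
theorem entireLFunction_ofReal_im (h : W.HasEntireLFunction) (x : ℝ) :
    (W.entireLFunction x).im = 0 :=
  Complex.conj_eq_iff_im.mp (W.conj_entireLFunction_ofReal h x)

end WeierstrassCurve

/-! ### The discriminant of the nine class-number-one fields: `d_K = d` -/

namespace Literature.NumberTheory.EllipticCurves.Quadratic

open Module

variable {K : Type*} [Field K] [NumberField K]

/-- **`d_K` divides the discriminant of the order `ℤ[θ]` with square quotient.** If
`[K : ℚ] = 2` and `θ ∈ K` is a root of `X² + uX + v ∈ ℤ[X]` with `u² - 4v < 0`, then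
`u² - 4v = disc(1, θ) = r² d_K` for a nonzero integer `r` (the index `[𝓞 K : ℤ[θ]]`);
from `exists_discr_basisOneSqrt_eq_sq_mul_discr` and `discr_basisOneSqrt_of_quadratic` of
`ClassNumberOne.lean`. Marcus, *Number Fields*, Ch. 2, Exercise 27(c). [folklore] -/
theorem exists_sq_mul_discr_eq_of_quadratic (h2 : finrank ℚ K = 2) {θ : K} {u v : ℤ}
    (hrel : θ ^ 2 + u * θ + v = 0) (hneg : u ^ 2 - 4 * v < 0) :
    ∃ r : ℤ, r ≠ 0 ∧ u ^ 2 - 4 * v = r ^ 2 * NumberField.discr K := by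
  have hrelQ : θ ^ 2 + algebraMap ℚ K u * θ + algebraMap ℚ K v = 0 := by
    simpa using hrel
  have hnegQ : (u : ℚ) ^ 2 - 4 * (v : ℚ) < 0 := by exact_mod_cast hneg
  have hθ : θ ∉ Set.range (algebraMap ℚ K) := QuadraticFields.Quadratic.not_mem_range_of_quadratic hrelQ hnegQ
  have hint : IsIntegral ℤ θ := by
    refine ⟨Polynomial.X ^ 2 + Polynomial.C u * Polynomial.X + Polynomial.C v, ?_, ?_⟩
    · rw [add_assoc]
      refine (Polynomial.monic_X_pow 2).add_of_left (lt_of_le_of_lt Polynomial.degree_linear_le ?_)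
      rw [Polynomial.degree_X_pow]
      norm_num
    · rw [Polynomial.eval₂_add, Polynomial.eval₂_add, Polynomial.eval₂_pow, Polynomial.eval₂_mul,
        Polynomial.eval₂_C, Polynomial.eval₂_X, Polynomial.eval₂_C, eq_intCast, eq_intCast]
      exact hrel
  obtain ⟨r, hr, h⟩ := QuadraticFields.Quadratic.exists_discr_basisOneSqrt_eq_sq_mul_discr h2 hθ hint
  rw [QuadraticFields.Quadratic.discr_basisOneSqrt_of_quadratic h2 hθ hrelQ] at h
  refine ⟨r, hr, ?_⟩
  exact_mod_cast h

/-- Elementary arithmetic: if `d = r² D` with `r ≠ 0`, `|D| > 2` and `d` is one of the nine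
class-number-one discriminants `-3, -4, -7, -8, -11, -19, -43, -67, -163`, then `D = d` (none of
`3, 4, 7, 8, 11, 19, 43, 67, 163` has a square factor `r² > 1` with cofactor of absolute value
`> 2`). [folklore] -/
theorem eq_of_mem_of_eq_sq_mul {d D r : ℤ} (h : d = r ^ 2 * D) (hr : r ≠ 0) (hD : 2 < |D|)
    (hd : d ∈ ({-3, -4, -7, -8, -11, -19, -43, -67, -163} : Finset ℤ)) : D = d := by
  have hdneg : d < 0 := by
    simp only [Finset.mem_insert, Finset.mem_singleton] at hd
    rcases hd with rfl | rfl | rfl | rfl | rfl | rfl | rfl | rfl | rfl <;> norm_num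
  have hdge : -163 ≤ d := by
    simp only [Finset.mem_insert, Finset.mem_singleton] at hd
    rcases hd with rfl | rfl | rfl | rfl | rfl | rfl | rfl | rfl | rfl <;> norm_num
  have hr2 : 0 < r ^ 2 := by positivity
  have hDneg : D < 0 := by
    by_contra hcon
    rw [not_lt] at hcon
    have : 0 ≤ r ^ 2 * D := mul_nonneg hr2.le hcon
    linarith
  have hD3 : D ≤ -3 := by
    rw [abs_of_neg hDneg] at hD
    linarith
  have hr54 : r ^ 2 ≤ 54 := by nlinarith
  have hr7 : r ≤ 7 := by nlinarith
  have hr7' : -7 ≤ r := by nlinarith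
  simp only [Finset.mem_insert, Finset.mem_singleton] at hd
  rcases hd with rfl | rfl | rfl | rfl | rfl | rfl | rfl | rfl | rfl <;>
    (interval_cases r <;> omega)

/-- **The discriminant of the nine imaginary quadratic fields of class number one.** If
`[K : ℚ] = 2` and `K` contains a square root of `d ∈ {-3, -4, -7, -8, -11, -19, -43, -67, -163}`
(so `K ≅ ℚ(√d)`), then `d_K = d`: for `d ≡ 1 (mod 4)` the algebraic integer `φ = (1 + √d)/2`
(a root of `X² - X + (1-d)/4`) has `disc(1, φ) = d = r² d_K`, and for `d = -4, -8` the integer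
`φ = √d/2` (a root of `X² - d/4`) has `disc(1, φ) = d = r² d_K`; since `|d_K| > 2` (Minkowski;
Mathlib `NumberField.abs_discr_gt_two`) this forces `r² = 1`. Marcus, *Number Fields*, Ch. 2,
Thm. 1 (`d_K = m` for `m ≡ 1 mod 4`, `d_K = 4m` otherwise, `K = ℚ(√m)`, `m` squarefree);
Silverman, *Advanced Topics*, App. A §3 ("discriminant `-D` of `K`", first column).
[folklore] -/
theorem discr_eq_of_sq_eq_intCast (h2 : finrank ℚ K = 2) {θ : K} {d : ℤ}
    (hθ : θ ^ 2 = (d : K)) (hd : d ∈ ({-3, -4, -7, -8, -11, -19, -43, -67, -163} : Finset ℤ)) :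
    NumberField.discr K = d := by
  have hDK : 2 < |NumberField.discr K| := NumberField.abs_discr_gt_two (by rw [h2]; norm_num)
  -- either `d = 1 - 4m` or `d = -4m`
  have hcases : (∃ m : ℤ, d = 1 - 4 * m ∧ 0 < m) ∨ (∃ m : ℤ, d = -4 * m ∧ 0 < m) := by
    simp only [Finset.mem_insert, Finset.mem_singleton] at hd
    rcases hd with rfl | rfl | rfl | rfl | rfl | rfl | rfl | rfl | rfl
    · exact Or.inl ⟨1, by norm_num, by norm_num⟩
    · exact Or.inr ⟨1, by norm_num, by norm_num⟩
    · exact Or.inl ⟨2, by norm_num, by norm_num⟩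
    · exact Or.inr ⟨2, by norm_num, by norm_num⟩
    · exact Or.inl ⟨3, by norm_num, by norm_num⟩
    · exact Or.inl ⟨5, by norm_num, by norm_num⟩
    · exact Or.inl ⟨11, by norm_num, by norm_num⟩
    · exact Or.inl ⟨17, by norm_num, by norm_num⟩
    · exact Or.inl ⟨41, by norm_num, by norm_num⟩
  rcases hcases with ⟨m, hdm, hm⟩ | ⟨m, hdm, hm⟩
  · -- `φ = (1 + θ)/2` is a root of `X² - X + m`
    have hrel : ((1 + θ) / 2) ^ 2 + ((-1 : ℤ) : K) * ((1 + θ) / 2) + ((m : ℤ) : K) = 0 := by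
      rw [hdm] at hθ
      push_cast at hθ ⊢
      linear_combination hθ / 4
    obtain ⟨r, hr, h⟩ := exists_sq_mul_discr_eq_of_quadratic h2 hrel (by nlinarith)
    have h' : d = r ^ 2 * NumberField.discr K := by rw [← h, hdm]; ring
    exact eq_of_mem_of_eq_sq_mul h' hr hDK hd
  · -- `φ = θ/2` is a root of `X² + m`
    have hrel : (θ / 2) ^ 2 + ((0 : ℤ) : K) * (θ / 2) + ((m : ℤ) : K) = 0 := by
      rw [hdm] at hθ
      push_cast at hθ ⊢
      linear_combination hθ / 4
    obtain ⟨r, hr, h⟩ := exists_sq_mul_discr_eq_of_quadratic h2 hrel (by nlinarith)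
    have h' : d = r ^ 2 * NumberField.discr K := by rw [← h, hdm]; ring
    exact eq_of_mem_of_eq_sq_mul h' hr hDK hd

end Literature.NumberTheory.EllipticCurves.Quadratic

/-! ### Covolumes: `covol(ℤ[ω_d]) = √|d|/2` and `covol(Ω·𝓞_K) = |Ω|² √|d_K|/2` -/

namespace Literature.NumberTheory.EllipticCurves

open WeierstrassCurve

/-- The unit square has Lebesgue measure one: the fundamental domain of the `ℝ`-basis `(1, i)`
of `ℂ` has volume `1`. [folklore] -/
theorem volume_real_fundamentalDomain_basisOneI :
    (volume : Measure ℂ).real (ZSpan.fundamentalDomain Complex.basisOneI) = 1 := by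
  rw [measureReal_congr (ZSpan.fundamentalDomain_ae_parallelepiped Complex.basisOneI volume),
    measureReal_def, Complex.coe_basisOneI, ← Complex.coe_orthonormalBasisOneI,
    Complex.orthonormalBasisOneI.volume_parallelepiped, ENNReal.toReal_one]

/-- **Covolume of a period lattice in terms of its periods**: the Lebesgue area of a
fundamental parallelogram of `ℤω₁ + ℤω₂` is `|re ω₁ · im ω₂ − re ω₂ · im ω₁| = |Im(ω̄₁ ω₂)|`.
[folklore] -/
theorem _root_.PeriodPair.covolume_lattice_eq (L : PeriodPair) :
    ZLattice.covolume L.lattice = |L.ω₁.re * L.ω₂.im - L.ω₂.re * L.ω₁.im| := by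
  rw [ZLattice.covolume_eq_det_mul_measureReal L.lattice volume L.latticeBasis Complex.basisOneI,
    volume_real_fundamentalDomain_basisOneI, mul_one]
  have h1 : ((↑) : L.lattice → ℂ) ∘ L.latticeBasis = L.basis := by
    ext i
    fin_cases i <;> simp
  rw [h1, Module.Basis.det_apply, Matrix.det_fin_two]
  simp [Module.Basis.toMatrix_apply, Complex.coe_basisOneI_repr]

/-- **`covol(𝓞_K) = √|d_K| / 2` for an imaginary quadratic field**, in the explicit form used
here: the lattice `ℤω_d + ℤ` spanned by the period pair `Λ_d = (ω_d, 1)` (`cmPeriodPair d`,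
`ω_d = (d + √d)/2`, `d < 0`; for a fundamental discriminant this is `𝓞_K = [1, w_K] ⊂ ℂ`,
`coe_cmPeriodPair_lattice`) has covolume `Im ω_d = √|d| / 2`. (Consistent with Mathlib's
`NumberField.mixedEmbedding.covolume_integerLattice`: `2^{-r₂} √|d_K|`, `r₂ = 1`.)
[folklore] -/
theorem covolume_cmPeriodPair {d : ℤ} (hd : d < 0) :
    ZLattice.covolume (cmPeriodPair d).lattice = Real.sqrt (-(d : ℝ)) / 2 := by
  rw [PeriodPair.covolume_lattice_eq, cmPeriodPair_ω₁ hd, cmPeriodPair_ω₂, cmGen_im]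
  simp only [Complex.one_im, Complex.one_re, mul_zero, zero_sub, one_mul, abs_neg]
  rw [abs_of_nonneg (by positivity)]

/-- A period lattice has a nonzero element, so `Λ = Ω · S` forces `Ω ≠ 0`. [folklore] -/
theorem ne_zero_of_coe_lattice_eq_image (L : PeriodPair) {Ω : ℂ} {S : Set ℂ}
    (h : (L.lattice : Set ℂ) = (fun α : ℂ => Ω * α) '' S) : Ω ≠ 0 := by
  rintro rfl
  have h1 : L.ω₁ ∈ (L.lattice : Set ℂ) := L.ω₁_mem_lattice
  rw [h] at h1
  obtain ⟨α, -, hα⟩ := h1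
  have h0 : L.ω₁ = 0 := by rw [← hα]; exact zero_mul α
  exact (LinearIndependent.ne_zero 0 L.indep) (by simpa using h0)

/-- If the lattice of `L` is `Ω · ℤ[ω_d]` then it is the lattice of the homothetic period pair
`Ω · Λ_d`. [folklore] -/
theorem lattice_eq_mulLeft_cmPeriodPair {d c : ℤ} (hd : d < 0) (hc : d * (d - 1) = 4 * c)
    (L : PeriodPair) {Ω : ℂ}
    (h : (L.lattice : Set ℂ) = (fun α : ℂ => Ω * α) '' (cmRing d : Set ℂ)) :
    L.lattice = ((cmPeriodPair d).mulLeft Ω (ne_zero_of_coe_lattice_eq_image L h)).lattice := by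
  have hΩ : Ω ≠ 0 := ne_zero_of_coe_lattice_eq_image L h
  refine SetLike.coe_injective ?_
  rw [h]
  ext x
  rw [SetLike.mem_coe, PeriodPair.mem_mulLeft_lattice, ← SetLike.mem_coe,
    coe_cmPeriodPair_lattice hd hc, Set.mem_image]
  constructor
  · rintro ⟨α, hα, rfl⟩
    rwa [SetLike.mem_coe, ← mul_assoc, inv_mul_cancel₀ hΩ, one_mul]
  · intro hx
    exact ⟨Ω⁻¹ * x, hx, by rw [← mul_assoc, mul_inv_cancel₀ hΩ, one_mul]⟩

/-- **`covol(Ω · 𝓞_K) = |Ω|² · √|d_K| / 2`**: the covolume of a period lattice which is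
`Ω · ℤ[ω_d]` (`covol(cΛ) = |c|² covol(Λ)`, `PeriodPair.covolume_mulLeft_lattice`, and
`covolume_cmPeriodPair`). This is the computation behind (periodnorm) of Burungale–Flach at
`F = K`: `N_{K/ℚ}(Ω𝓞_K)`-covolume. [folklore] -/
theorem covolume_of_coe_lattice_eq_image_cmRing {d c : ℤ} (hd : d < 0)
    (hc : d * (d - 1) = 4 * c) (L : PeriodPair) {Ω : ℂ}
    (h : (L.lattice : Set ℂ) = (fun α : ℂ => Ω * α) '' (cmRing d : Set ℂ)) :
    ZLattice.covolume L.lattice = ‖Ω‖ ^ 2 * (Real.sqrt (-(d : ℝ)) / 2) := by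
  have hlat := lattice_eq_mulLeft_cmPeriodPair hd hc L h
  rw [← covolume_cmPeriodPair hd,
    ← PeriodPair.covolume_mulLeft_lattice _ _ (ne_zero_of_coe_lattice_eq_image L h)]
  simp only [hlat]

/-- The lattice of the homothetic period pair `cΛ` when `Λ = Ω · S`: `cΛ = (cΩ) · S`.
[folklore] -/
theorem coe_mulLeft_lattice_of_eq_image (L : PeriodPair) {c Ω : ℂ} (hc : c ≠ 0) {S : Set ℂ}
    (h : (L.lattice : Set ℂ) = (fun α : ℂ => Ω * α) '' S) :
    ((L.mulLeft c hc).lattice : Set ℂ) = (fun α : ℂ => (c * Ω) * α) '' S := by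
  ext x
  rw [SetLike.mem_coe, PeriodPair.mem_mulLeft_lattice, ← SetLike.mem_coe, h, Set.mem_image,
    Set.mem_image]
  constructor
  · rintro ⟨α, hα, hαx⟩
    refine ⟨α, hα, ?_⟩
    have : c * (Ω * α) = c * (c⁻¹ * x) := by rw [hαx]
    rw [← mul_assoc, ← mul_assoc, mul_inv_cancel₀ hc, one_mul] at this
    exact this
  · rintro ⟨α, hα, rfl⟩
    refine ⟨α, hα, ?_⟩
    rw [← mul_assoc, ← mul_assoc, inv_mul_cancel₀ hc, one_mul]

/-! ### The CM field: discriminant, units, and the period over `K` -/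

variable {K : Type*} [Field K] [NumberField K]

/-- The two tables `cmFieldDiscr` (`ComplexMultiplicationBurungaleFlachDescent.lean`) and
`cmDiscr` (`ComplexMultiplicationCoatesWiles.lean`) agree (same definition). [folklore] -/
theorem cmFieldDiscr_eq_cmDiscr (j : ℚ) : cmFieldDiscr j = cmDiscr j := rfl

/-- **The discriminant of the CM field**: a number field `K` with `IsCMFieldOfJ K j`
(`[K : ℚ] = 2`, `d_K(j)` a square in `K`) has `NumberField.discr K = cmFieldDiscr j`, i.e.
`d_K = -3, -4, -7, -8, -11, -19, -43, -67, -163` for the nine `j ∈ maximalCMJInvariants`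
(Silverman, *Advanced Topics*, App. A §3, first column), by
`Literature.NumberTheory.EllipticCurves.Quadratic.discr_eq_of_sq_eq_intCast`. [cite: SilvermanATAEC1994, App. A §3 (first table)] -/
theorem IsCMFieldOfJ.discr_eq {j : ℚ} (hj : j ∈ maximalCMJInvariants) (hK : IsCMFieldOfJ K j) :
    NumberField.discr K = cmFieldDiscr j := by
  obtain ⟨θ, hθ⟩ := hK.2
  exact Literature.NumberTheory.EllipticCurves.Quadratic.discr_eq_of_sq_eq_intCast hK.1 hθ (cmFieldDiscr_mem hj)

/-- **Units of an imaginary quadratic field have absolute value one under every embedding**: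
if `K` has a single infinite place (e.g. `IsCMFieldOfJ K j`, `IsCMFieldOfJ.card_infinitePlace`)
then `|σ(u)| = 1` for `u ∈ 𝓞_K^×` and `σ : K → ℂ`, since `∏_w ‖u‖_w = |N_{K/ℚ}(u)| = 1`
(Mathlib `InfinitePlace.prod_eq_abs_norm`, `NumberField.isUnit_iff_norm`) has the single factor
`|σ u|²`. This is the case `A = 𝓞_K/(u) = 0` of "`N_{K/ℚ}(|A|_K) = |A|`" used in the proof of
Burungale–Flach, Cor. 1. [folklore] -/
theorem norm_embedding_unit_eq_one (h1 : Fintype.card (InfinitePlace K) = 1) (σ : K →+* ℂ)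
    (u : (𝓞 K)ˣ) : ‖σ ((u : 𝓞 K) : K)‖ = 1 := by
  have hprod := InfinitePlace.prod_eq_abs_norm ((u : 𝓞 K) : K)
  have hnorm : |Algebra.norm ℚ ((u : 𝓞 K) : K)| = 1 := by
    have := NumberField.isUnit_iff_norm.mp u.isUnit
    rwa [RingOfIntegers.coe_norm] at this
  rw [hnorm, Rat.cast_one] at hprod
  have hsub : Subsingleton (InfinitePlace K) := Fintype.card_le_one_iff_subsingleton.mp h1.le
  have huniv : (Finset.univ : Finset (InfinitePlace K)) = {InfinitePlace.mk σ} := by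
    ext v
    simp [Subsingleton.elim v (InfinitePlace.mk σ)]
  rw [huniv, Finset.prod_singleton] at hprod
  have hw : (InfinitePlace.mk σ) ((u : 𝓞 K) : K) = 1 :=
    (pow_eq_one_iff_of_nonneg (apply_nonneg _ _) (InfinitePlace.mult_pos).ne').mp hprod
  rw [← hw, InfinitePlace.apply]

/-- Base change commutes with extension of scalars along an embedding: for `W/ℚ`,
`C : VariableChange K` and `σ : K → ℂ`, `(C • W_K).map σ = C^σ • W_ℂ` (all ring maps `ℚ → ℂ`
agree). [folklore] -/
theorem map_smul_baseChange_eq (W : WeierstrassCurve ℚ) (C : VariableChange K) (σ : K →+* ℂ) :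
    (C • W.baseChange K).map σ = (C.map σ) • W.baseChange ℂ := by
  rw [← map_variableChange]
  congr 1
  have h := W.map_baseChange (S := ℚ) (A := K) (B := ℂ) σ.toRatAlgHom
  rwa [RingHom.toRatAlgHom_toRingHom] at h

/-- **(periodnorm) at `F = K`: `Ω(E) = |Ω|²`.** Let `K` be the CM field (`IsCMFieldOfJ K j`,
`j ∈ maximalCMJInvariants`), `V` a Weierstrass model over `K`, `w` the infinite place of `K`, and
`L` a period pair of `V` along `w.embedding` whose lattice is `Ω · 𝓞_K`
(`𝓞_K = ℤ[ω_{d_K}] = cmRing d_K ⊂ ℂ`). Then the BSD period of `ComplexPeriod.lean` is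
`bsdPeriod V = 2 covol(Ω𝓞_K) / √|d_K| = 2 |Ω|² (√|d_K|/2) / √|d_K| = |Ω|²` — Burungale–Flach,
eq. (periodnorm): `ℤ·Ω(E) = N_{K/ℚ}𝔞 = ΩΩ̄·𝔞(Ω)𝔞(Ω)bar` with `𝔞 = Ω𝓞_K`, `𝔞(Ω) = (1)`. Uses
`bsdPeriod_eq_of_isCMFieldOfJ` (one complex place), the uniqueness of the period lattice
(`PeriodPair.uniformization_unique_holds`), `covolume_of_coe_lattice_eq_image_cmRing` and
`IsCMFieldOfJ.discr_eq`. [cite: BurungaleFlach2024, eq. (periodnorm) and Remark 2 (arXiv pp. 3–4)] -/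
theorem bsdPeriod_eq_norm_sq_of_coe_lattice_eq {j : ℚ} (hj : j ∈ maximalCMJInvariants)
    (hK : IsCMFieldOfJ K j) (V : WeierstrassCurve K) (w : InfinitePlace K) {L : PeriodPair}
    (h₂ : L.g₂ = (V.map w.embedding).c₄ / 12) (h₃ : L.g₃ = (V.map w.embedding).c₆ / 216)
    {Ω : ℂ} (hΛ : (L.lattice : Set ℂ) = (fun α : ℂ => Ω * α) '' (cmRing (cmDiscr j) : Set ℂ)) :
    V.bsdPeriod = ‖Ω‖ ^ 2 := by
  obtain ⟨hd, c, hc⟩ := neg_and_exists_of_mem_cmDiscrs (cmDiscr_mem_cmDiscrs hj)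
  have hdisc : NumberField.discr K = cmDiscr j := by
    rw [← cmFieldDiscr_eq_cmDiscr]; exact hK.discr_eq hj
  rw [bsdPeriod_eq_of_isCMFieldOfJ hj hK V w,
    (V.map w.embedding).complexPeriod_eq_two_mul_covolume PeriodPair.uniformization_unique_holds
      h₂ h₃,
    covolume_of_coe_lattice_eq_image_cmRing hd hc L hΛ, hdisc]
  have hs : Real.sqrt |((cmDiscr j : ℤ) : ℝ)| = Real.sqrt (-(cmDiscr j : ℝ)) := by
    rw [abs_of_neg (by exact_mod_cast hd)]
  rw [hs]
  have hpos : 0 < Real.sqrt (-(cmDiscr j : ℝ)) :=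
    Real.sqrt_pos.mpr (by exact_mod_cast neg_pos.mpr hd)
  field_simp

/-! ### Level-3 named fact: Theorem 1.1 (with Remark 1) at `F = K` -/

/-- **Burungale–Flach 2024, Theorem 1.1 with Remark 1, at `F = K`, for the base change of a CM
curve over `ℚ` — transcribed.** Printed (Camb. J. Math. 12 (2024), Thm. 1.1, arXiv p. 3):
*"Let `E/F` be an elliptic curve over a number field `F` with CM by `𝓞_K` for an imaginary
quadratic field `K` and such that `F(E_tors)/K` is abelian. Let `ψ` be the Hecke character
associated to `E/F` and assume that `L(ψ̄,1) ≠ 0`. Then `E(F)` and `Ш(E/F)` are finite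
`𝓞_K`-modules, `L(ψ̄,1)/Ω ∈ K^×` and `L(ψ̄,1)/Ω = |Ш(E/F)|_K / |E(F)| · ∏_v |Φ_v|_K · 𝔞(Ω)` in
the group of fractional `𝓞_K`-ideals"* — where `⊗_{v∣∞} H_1(E(F_v),ℤ) = 𝔞 · det_{𝓞_K}
Hom_{𝓞_F}(H⁰(ℰ,Ω_{ℰ/𝓞_F}),𝓞_F)` under the determinant of the period isomorphism,
`𝔞 = Ω·𝔞(Ω)` with `Ω ∈ K_ℝ^× ≅ ℂ^×` and `𝔞(Ω) ⊆ K` a fractional ideal, `|A|_K` is the order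
ideal of a finite `𝓞_K`-module, `|E(F)|` the cardinality (a principal ideal) and `Φ_v` the
component group of the Néron model at `v` — and Remark 1: *"the ideal `|Ш(E/F)|_K` is generated
by a rational integer [Gross, Prop. 3.7]. The ideals `|Φ_v|_K` are equal to either `(1)`, `(2)`
or `𝔭` with `𝔭² = (2)` or `𝔭² = (3)` [Gross, Prop. 4.5]"*; p. 4: *"Any elliptic curve `E/K`
with CM by `𝓞_K` for which `L(E/K,1) ≠ 0` satisfies the assumptions of Theorem 1.1 and
Corollary 1. In this case the class number of `K` is `1`."*

Here `F = K` and `E = E_K` is the base change of `E/ℚ` with `j(E) ∈ maximalCMJInvariants`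
(CM by `𝓞_K`, all endomorphisms defined over `K`) and `L(E/ℚ,1) ≠ 0` (so
`L(E_K/K,1) = L(E/ℚ,1)² ≠ 0`, Deuring), `K` any number field with `IsCMFieldOfJ K j(E)` and
`W'` a globally minimal model of `E_K` (`∃ C, C • W.baseChange K = W'`), exactly the data of
the level-2 leaf `BurungaleFlach2024_bsd_cmField`. Dictionary (see the module docstring):
* `σ : K →+* ℂ` is the identification `K_ℝ ≅ ℂ`; `L` is the period lattice of the Néron
  differential `ω` of `W'` along `σ` (`g₂(L) = c₄/12`, `g₃(L) = c₆/216` for `W'.map σ`), which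
  for `F = K` *is* the invertible `𝓞_K`-module `𝔞` (evaluate at the `𝓞_K`-basis `ω` of
  `H⁰(ℰ,Ω)`; `I_ω = 1`, Remark 2); `Ω` is an `𝓞_K`-generator of it, `L.lattice = Ω · 𝓞_K`
  with `𝓞_K = ℤ[ω_{d_K}] = cmRing (cmDiscr j(E)) ⊂ ℂ` (as in `IsCMPeriod`), i.e. the
  normalisation `𝔞(Ω) = (1)` permitted by `h_K = 1`;
* `L(ψ̄,1) = L(E/ℚ,1) = W.entireLFunction 1` (Silverman *AT* II.10.5(b):
  `L(E/ℚ,s) = L(s, ψ_{E_K/K})`, with integer coefficients, so `L(s,ψ̄) = L(s,ψ)`; the value at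
  `1` by the entire continuation), and "`L(ψ̄,1)/Ω ∈ K^×`" reads `∃ z : K, σ z · Ω = L(E/ℚ,1)`;
* `|E(K)| = Nat.card W'(K)`, `|Ш(E/K)| = W'.shaOrder`, `|Φ_v| = c_v`, `∏_v c_v =
  W'.tamagawaProduct`; by Remark 1 and `N_{K/ℚ}|A|_K = |A|`: `|Ш|_K² = (|Ш|)` and
  `|Φ_v|_K² = (c_v)`, so the printed identity of fractional ideals, squared, is
  `(z)² (|E(K)|)² = (|Ш|) (∏_v c_v)`, i.e. `z² |E(K)|² = u · |Ш| · ∏_v c_v` for a unit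
  `u ∈ 𝓞_K^×` — equivalent to the printed one by unique factorisation of ideals in `𝓞_K`.
[cite: BurungaleFlach2024, Thm. 1.1 and Remark 1 (arXiv p. 3), with p. 4 (first two sentences) and Remark 2] -/
def BurungaleFlach2024_main_cmField : Prop :=
  ∀ (W : WeierstrassCurve ℚ) [W.IsElliptic], W.j ∈ maximalCMJInvariants →
    W.entireLFunction 1 ≠ 0 →
    ∀ (K : Type) [Field K] [NumberField K], IsCMFieldOfJ K W.j →
      ∀ (W' : WeierstrassCurve K) [W'.IsElliptic] [W'.IsGloballyMinimal],
        (∃ C : VariableChange K, C • W.baseChange K = W') →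
        ∀ (σ : K →+* ℂ) (L : PeriodPair) (Ω : ℂ),
          L.g₂ = (W'.map σ).c₄ / 12 → L.g₃ = (W'.map σ).c₆ / 216 →
          (L.lattice : Set ℂ) = (fun α : ℂ => Ω * α) '' (cmRing (cmDiscr W.j) : Set ℂ) →
            Finite W'.toAffine.Point ∧ W'.ShaFinite ∧
              ∃ (z : K) (u : (𝓞 K)ˣ), σ z * Ω = W.entireLFunction 1 ∧
                z ^ 2 * (Nat.card W'.toAffine.Point : K) ^ 2 =
                  ((u : 𝓞 K) : K) * (W'.shaOrder : K) * (W'.tamagawaProduct : K)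

/-! ### Assembly: Theorem 1.1 ⇒ Corollary 1 (the level-2 leaf) ⇒ bsd.S28 -/

/-- The arithmetic of the three-line proof of Corollary 1, isolated: if `z Ω = r` with `r` real,
`|v| = 1` and `z² n² = v · s · t`, then `r²/|Ω|² = s/n² · t` (`r² = r r̄ = |z|²|Ω|²` and
`|z|² n² = s t`). [folklore] -/
theorem sq_div_norm_sq_eq_of_norm_eq (r Ω z v : ℂ) (n s t : ℕ) (hn : n ≠ 0) (hΩ : Ω ≠ 0)
    (hz : z * Ω = r) (hreal : conj r = r) (hv : ‖v‖ = 1)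
    (hzv : z ^ 2 * (n : ℂ) ^ 2 = v * s * t) :
    r ^ 2 / ((‖Ω‖ ^ 2 : ℝ) : ℂ) = (s : ℂ) / (n : ℂ) ^ 2 * (t : ℂ) := by
  -- norms of the ideal equation: `|z|² n² = s t`
  have hnorm : ‖z‖ ^ 2 * (n : ℝ) ^ 2 = (s : ℝ) * t := by
    have := congrArg (fun x : ℂ => ‖x‖) hzv
    simp only [norm_mul, norm_pow, Complex.norm_natCast, hv, one_mul] at this
    exact this
  -- `r² = |z|² |Ω|²`
  have hr2 : r ^ 2 = (‖z‖ : ℂ) ^ 2 * (‖Ω‖ : ℂ) ^ 2 := by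
    have h1 : r ^ 2 = r * conj r := by rw [hreal, sq]
    rw [h1, ← hz, map_mul, ← Complex.mul_conj', ← Complex.mul_conj']
    ring
  have hΩ' : (‖Ω‖ : ℂ) ≠ 0 := by exact_mod_cast (norm_ne_zero_iff.mpr hΩ)
  have hn' : (n : ℂ) ≠ 0 := by exact_mod_cast hn
  have hnorm' : ((‖z‖ ^ 2 * (n : ℝ) ^ 2 : ℝ) : ℂ) = (((s : ℝ) * t : ℝ) : ℂ) := by rw [hnorm]
  push_cast at hnorm' ⊢
  rw [hr2, mul_div_assoc, div_self (pow_ne_zero 2 hΩ'), mul_one, div_mul_eq_mul_div,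
    eq_div_iff (pow_ne_zero 2 hn'), hnorm']

/-- **Corollary 1 at `F = K` from Theorem 1.1, by the printed proof** (Burungale–Flach 2024,
proof of Cor. 1, arXiv p. 3). Given Theorem 1.1 over `K` (`hT`), the CM period lattice
`Λ_E = Ω𝓞_K` (`hΛ`, Coates–Wiles §1 / Burungale–Flach p. 3 with `h_K = 1`), Deuring's
`L(E_K/K,s) = L(E/ℚ,s)²` (`hD`) and modularity (`hmod`): for `W, K, W' = C • W_K` as in the
leaf, choose the infinite place `w` of `K` and `σ = σ_w`; the period lattice of `W'` along `σ`
is `σ(u)·Λ_E = (σ(u)Ω)·𝓞_K` (`ω_{C•W} = uω_W`); Theorem 1.1 gives finiteness and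
`z, v` with `σz · σ(u)Ω = L(E/ℚ,1)`, `z²|E(K)|² = v|Ш|∏c_v`; then
`L(E_K/K,1) = L(E/ℚ,1)² = |L(E/ℚ,1)|²` (`conj_entireLFunction_ofReal`: Shimura's
`L(E/F,1) = L(ψ̄,1) conj L(ψ̄,1)`), `Ω(E_K) = |σ(u)Ω|²` (`bsdPeriod_eq_norm_sq_of_coe_lattice_eq`:
(periodnorm)) and `|σz|²|E(K)|² = |Ш|∏c_v` (`norm_embedding_unit_eq_one`: `N_{K/ℚ}`), whence
`L(E_K/K,1)/Ω(E_K) = |σ z|² = |Ш(E/K)| ∏_v c_v / |E(K)|²`.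
[cite: BurungaleFlach2024, Cor. 1 and its proof (arXiv p. 3)] -/
theorem BurungaleFlach2024_bsd_cmField_of_main (hT : BurungaleFlach2024_main_cmField)
    (hΛ : exists_isCMPeriod_of_j_mem_maximalCMJInvariants)
    (hD : Deuring_LFunction_baseChange_cmField) (hmod : hasEntireLFunction_rat) :
    BurungaleFlach2024_bsd_cmField := by
  intro W _ hj hL K _ _ hK W' _ _ hW'
  obtain ⟨C, rfl⟩ := hW'
  -- the infinite place and the embedding
  obtain ⟨w⟩ : Nonempty (InfinitePlace K) := inferInstance
  set σ : K →+* ℂ := w.embedding with hσ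
  -- the CM period of `W`: `Λ_W = Ω · 𝓞_K`
  obtain ⟨Ω, L, ⟨h₂, h₃⟩, hLΩ⟩ := hΛ W hj
  -- the period lattice of `W' = C • W_K` along `σ` is `σ(u) · Λ_W`
  have hu : σ (C.u : K) ≠ 0 := (map_ne_zero σ).mpr C.u.ne_zero
  have hmap : (C • W.baseChange K).map σ = (C.map σ) • W.baseChange ℂ :=
    map_smul_baseChange_eq W C σ
  have hCu : (((C.map σ).u : ℂˣ) : ℂ) = σ (C.u : K) := by
    rw [VariableChange.map_u, Units.coe_map, MonoidHom.coe_coe]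
  have hinv : (((C.map σ).u⁻¹ : ℂˣ) : ℂ) = (σ (C.u : K))⁻¹ := by
    rw [Units.val_inv_eq_inv_val, hCu]
  have h₂' : (L.mulLeft _ hu).g₂ = ((C • W.baseChange K).map σ).c₄ / 12 := by
    rw [hmap, PeriodPair.g₂_mulLeft, variableChange_c₄, h₂, hinv, inv_pow]
    ring
  have h₃' : (L.mulLeft _ hu).g₃ = ((C • W.baseChange K).map σ).c₆ / 216 := by
    rw [hmap, PeriodPair.g₃_mulLeft, variableChange_c₆, h₃, hinv, inv_pow]
    ring
  have hL'Ω : ((L.mulLeft _ hu).lattice : Set ℂ) =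
      (fun α : ℂ => (σ (C.u : K) * Ω) * α) '' (cmRing (cmDiscr W.j) : Set ℂ) :=
    coe_mulLeft_lattice_of_eq_image L hu hLΩ
  -- Theorem 1.1 over `K`
  obtain ⟨hfin, hsha, z, v, hz, hzv⟩ :=
    hT W hj hL K hK (C • W.baseChange K) ⟨C, rfl⟩ σ (L.mulLeft _ hu) (σ (C.u : K) * Ω) h₂' h₃'
      hL'Ω
  refine ⟨hfin, hsha, ?_⟩
  -- (periodnorm): `Ω(E_K) = |σ(u) Ω|²`
  have hΩ : (C • W.baseChange K).bsdPeriod = ‖σ (C.u : K) * Ω‖ ^ 2 :=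
    bsdPeriod_eq_norm_sq_of_coe_lattice_eq hj hK (C • W.baseChange K) w h₂' h₃' hL'Ω
  have hΩ0 : σ (C.u : K) * Ω ≠ 0 :=
    mul_ne_zero hu (ne_zero_of_coe_lattice_eq_image L hLΩ)
  -- Shimura / Deuring: `L(E_K/K, 1) = L(E/ℚ,1)² = |L(E/ℚ,1)|²`
  haveI : (W.baseChange K).IsElliptic := by rw [baseChange]; infer_instance
  have hLK : (C • W.baseChange K).entireLFunction 1 = W.entireLFunction 1 ^ 2 := by
    rw [entireLFunction_smul]
    exact entireLFunction_one_eq_sq_of_LFunction_eq_mul_self (hmod W) (hD W hj K hK)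
  have hreal : conj (W.entireLFunction 1) = W.entireLFunction 1 := by
    have := W.conj_entireLFunction_ofReal (hmod W) 1
    rwa [Complex.ofReal_one] at this
  -- `N_{K/ℚ}`: units have absolute value `1`
  have hv : ‖σ ((v : 𝓞 K) : K)‖ = 1 :=
    norm_embedding_unit_eq_one (hK.card_infinitePlace hj) σ v
  -- `E(K)` is finite and nonempty
  haveI := hfin
  have hcard : Nat.card (C • W.baseChange K).toAffine.Point ≠ 0 := Nat.card_pos.ne'
  -- the ideal identity under `σ`
  have hzv' : (σ z) ^ 2 * (Nat.card (C • W.baseChange K).toAffine.Point : ℂ) ^ 2 =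
      σ ((v : 𝓞 K) : K) * ((C • W.baseChange K).shaOrder : ℂ) *
        ((C • W.baseChange K).tamagawaProduct : ℂ) := by
    have := congrArg σ hzv
    simpa using this
  rw [hLK, hΩ]
  exact sq_div_norm_sq_eq_of_norm_eq (W.entireLFunction 1) _ (σ z) _ _ _ _ hcard hΩ0 hz hreal hv
    hzv'

/-- **The level-2 leaf from Theorem 1.1 and the singular moduli** (variant): the CM period
input of `BurungaleFlach2024_bsd_cmField_of_main` is itself reduced in the tree to the seven
remaining rows of the table of singular moduli (`singularModuli_classNumberOne`,
`ComplexMultiplicationSingularModuli.lean`). [cite: BurungaleFlach2024, Cor. 1 (arXiv p. 3)] -/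
theorem BurungaleFlach2024_bsd_cmField_of_main_of_singularModuli
    (hT : BurungaleFlach2024_main_cmField) (hS : singularModuli_classNumberOne)
    (hD : Deuring_LFunction_baseChange_cmField) (hmod : hasEntireLFunction_rat) :
    BurungaleFlach2024_bsd_cmField :=
  BurungaleFlach2024_bsd_cmField_of_main hT
    (exists_isCMPeriod_of_j_mem_maximalCMJInvariants_of_singularModuli hS) hD hmod

/-- **bsd.S28 from Theorem 1.1 of Burungale–Flach and the standard facts of levels 1–3.**
`bsdTriple_of_j_mem_maximalCMJInvariants_of_L_one_ne_zero` follows from Theorem 1.1 over the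
CM field (`hT`), the CM period lattice (`hΛ`), Deuring (`hD`), modularity (`hmod`) — giving
Corollary 1 over `K` by `BurungaleFlach2024_bsd_cmField_of_main` — and the descent inputs of
`ComplexMultiplicationBurungaleFlachDescentProofs.lean` (Artin formalism `hBCL`, Milne's
theorem `hBC`, Cassels' isogeny invariance `hISO`, Knapp 11.67 `hKn`, `L(E,1) ≥ 0` `hPOS`, the
CM isogeny `E ∼ E^{(d_K)}` `hTW`), through the level-3 descent assembly.
[cite: BurungaleFlach2024, Thm 1.1, Cor. 1, Cor. 2 (arXiv pp. 3–4)] -/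
theorem bsdTriple_of_j_mem_maximalCMJInvariants_of_L_one_ne_zero_of_main
    (hT : BurungaleFlach2024_main_cmField)
    (hΛ : exists_isCMPeriod_of_j_mem_maximalCMJInvariants)
    (hD : Deuring_LFunction_baseChange_cmField) (hmod : hasEntireLFunction_rat)
    (hBCL : LSeries_baseChange_quadratic) (hBC : bsdRHS_baseChange_quadratic)
    (hISO : bsdRHS_eq_of_isIsogenous) (hKn : LFunction_eq_of_isIsogenous)
    (hPOS : re_entireLFunction_one_nonneg) (hTW : isIsogenous_quadraticTwist_cmFieldDiscr) :
    bsdTriple_of_j_mem_maximalCMJInvariants_of_L_one_ne_zero :=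
  bsdTriple_of_j_mem_maximalCMJInvariants_of_L_one_ne_zero_of_level3
    (BurungaleFlach2024_bsd_cmField_of_main hT hΛ hD hmod) hmod hBCL hBC hISO hKn hPOS hTW

end Literature.NumberTheory.EllipticCurves

end
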